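import Summits.HodgeConjecture.HodgeConjecture.Theorems.F0P6aRGDAssemblyDefs
import Literature.AlgebraicGeometry.AbelianSchemes.AbelianSchemeQuotientDualPairOfIdealTorsion
import Literature.AlgebraicGeometry.AbelianSchemes.QuotientDualPairKernelLawOfIdealClass
import Literature.AlgebraicGeometry.AbelianSchemes.FibreHomDominantOfRingAction
import Literature.AlgebraicGeometry.AbelianSchemes.RosatiSpreadStage
import Literature.AlgebraicGeometry.AbelianSchemes.AbelianSchemeOverHomNoetherianAnyBase
import Literature.AlgebraicGeometry.AbelianSchemes.AbelianSchemeConstSubgroupQuotientOfField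
import Literature.NumberTheory.NumberFields.GaloisConjugatePrimeIdealArithmetic
import HarnessLib

/-!
# `F0P6aQuotientFibreEngineInputs` — ★ RE-HOME of the crux workfile `Lines/F0_P6a_QuotientFibreEngineInputs.lean` (tree sha16 df27cd023cd3ec5d, 361 l., 19 declaration commands, code-`sorry`-free)

This `Theorems/` module is the TREE BYTES of that workfile with the NAMESPACE KEPT, so every fully-qualified name is UNCHANGED; only this module docstring is re-headed,
the `Lines` imports are switched to their ★ re-homed twins — `Lines.F0_P6a_RGDAssembly` → ★ `Theorems.F0P6aRGDAssemblyDefs` — and the audit carrier `LibrarySuggestionsDenyListCruxes` is dropped (it stays in the `Lines/` shim).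
Why a re-home: a `Theorems/` file cannot import a `Lines/` workfile (F0P6-ref1 o-6), and closing stmt-HodgeConjecture-24832 `--as proved --by <Theorems decl>` at rung 0 needs the
sorry-free `Lines` chain behind the gate (RE-HOME TABLE v1.7, LA7-plan (g7); PLAN «L3 cone RE-HOME» v1, LA3-plan (g5); LEAD F0P6-plan (g5) «M-140» (1)∕(4), 2026-09-02).
One part (≤ 400 l.); this is the module the `Lines/` shim and consumers import.
After the chain is ★ the `Lines` workfile becomes a one-import SHIM of `F0P6aQuotientFibreEngineInputs` (a `Lines/` write, batched per cone on the LEAD՚s word), so no environment holds two copies (NO-CROSS-IMPORT).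
It asserts nothing beyond what the workfile already proves.  HC_CM is proved only modulo the 7 printed citations (2 remaining: hLiu418 = stmt-HodgeConjecture-24832, h413 = stmt-HodgeConjecture-24833) until rung 0 closes; a re-home is count-neutral.

## Original module docstring (verbatim)
# F0 · P6a — LEAFLET `Lines/F0_P6a_QuotientFibreEngineInputs.lean` ED. 1: the «DUAL-Q» engine binders DISCHARGED at the special fibre `A_x̄ = sch₀Of 𝓜 w I.univ x̄`
# of the localised PEL tuple `I : RGDInputsAt …` (line L3 ROOF road «DUAL-B̄», LA3-plan RULING #6 (2a) ∕ DEAL UPDATE 05:05:48Z; LA1-p03 (g3))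

`crux_decl: Summit.HodgeConjecture.HodgeConjecture.Theses.HCCMUnconditional.HLiu418`.  Cell `hodgecm-mathlib` (D-0151), «GO 500» half A; item stmt-HodgeConjecture-24832
(count-neutral; nothing registered; no socket statement touched).  EDITION 1 = LA1-p03 (g3) HOME cand v3 (code byte-identical to v2 bae8561db5284bb7, GREEN + TRIO by import
of the served spine ED. 4; header retitled as the leaflet); writer = the L3 pen on the LEAD heir's word (LA3-p01 (g2) 06:05:16Z: the ROOF-LEGS leaflet v3 imports this
module BY NAME).  THEOREMS ONLY.  Namespace `Summit.HodgeConjecture.HodgeConjecture.Cruxes.HLiu418.F0P6aQuotientFibreEngineInputs`.  A `Theorems/` file may not import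
`Cruxes/…/Lines` (gate `lint.import`), hence a `Lines/` leaflet.  HC_CM is proved only modulo the 7 printed citations (2 remaining: hLiu418 = stmt-HodgeConjecture-24832,
h413 = stmt-HodgeConjecture-24833) until rung 0 closes.

At `A := sch₀Of 𝓜 w I.univ x̄ = (I.univ.baseChange ι_s).baseChange x̄.left` over `Spec κ̄(w)` (`ι_s := pullback.fst (𝓜.localise w).total.hom (specResidueField w)`),
`D := dual₀Of 𝓜 w I.univ I.dual x̄`, `lam := (pol₀Of 𝓜 w I.univ I.pol x̄).lam`, `act := (I.act.baseChange ι_s).baseChange x̄.left` (spine §4 ∕ D-line :189 spelling),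
`O := 𝓞 F`, one theorem per binder of ★ `nonempty_dualPair_quotient_idealTorsion_geometric` (p849273), each concluding EXACTLY the binder's type:
* `[IsCommMonObj A.X]`, `[IsCommMonObj D.hat.X]` — ★ `isCommMonObj_of_isLocallyNoetherian_base` (any abelian scheme over the Noetherian `Spec κ̄`);
* `[IsSeparated (A.X.hom ≫ 𝟙 _)]`, `[LocallyOfFiniteType (A.X.hom ≫ 𝟙 _)]` (and for `D.hat`) — ★ QF `isSeparated_hom_comp_id` ∕ `locallyOfFiniteType_hom_comp_id`;
* `hA : A.IsOfRelDim I.g` — `I.relDim` base-changed twice (★ `IsOfRelDim.baseChange`);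
* `[IsMonHom lam]`, `hpol` — the `Polarization` structure of `pol₀Of` (`isMonHom`, `exists_ample`, ampleness dropped);
* `hsurj` — ★ p849277 `map_fibreHom_i_surjective_of_ne_zero` (any `𝓞 F`-action, any base);
* `hros` — the ROSATI ROW `I.rosati` (`ι(b̄) ≫ λ = λ ≫ ι(b)^∨` for `(b̄ : F) = c (b : F)`) carried through the two base changes by ★ `RingAction.rosati_row_baseChange`
  (`rosati_sch₀Of`), DOMINANCE of `ι(b)_s` for `b ≠ 0` by ★ `isDominant_toSchemeHom_fibreHom_i_of_ne_zero`, packaged for any pair of ideals `𝔟, 𝔟′` with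
  `∀ j ∈ 𝔟′, ∃ b ∈ 𝔟, (j : F) = c (b : F)` (`hros_sch₀Of`), in particular `𝔟′ := c • 𝔟` (`hros_sch₀Of_complexConj_smul`).
§3 TIE: the rows feed ★ p849273 at `A_x̄` with the numerology ∕ kernels ∕ level structure ∕ count left as binders (`nonempty_dualPair_quotient_sch₀Of`).  §4: the costume of
LA3-p03's ★ (2b) head `exists_idealClass_quotient_kernelLaw_dualPair` (p849490) — `hchar_sch₀Of` (`p ∣ M ⇒` every prime vanishing in `κ̄(w)` divides `M`), `hrosati_sch₀Of`
(`c := toRingEquiv (complexConj F)`, the costume `((c b : 𝓞 F) : F) = c (b : F)` is `rfl`), and the head AT x̄ `exists_idealClass_quotient_kernelLaw_dualPair_sch₀Of` with every tuple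
row discharged (the consumer supplies only `𝔞 ≠ 0`, `M ≠ 0`, `p ∣ M`; its type is spelled `type_of% (@… ‹rows›)` = the instantiation token for token, cheap to elaborate).

## References
* [MumfordAV1970] D. Mumford, *Abelian Varieties* (1970), §6 Application 2 (p. 62), §15 Thm. 1 (p. 143), §20 (p. 186), §23 Thm. 2 (p. 231).
* [MumfordFogartyKirwan1994] D. Mumford, J. Fogarty, F. Kirwan, *Geometric Invariant Theory*, 3rd ed. (1994), Ch. 6 §1 Cor. 6.5 (p. 117), §2 Def. 6.3 (p. 120), Ch. 7 §2 Def. 7.2 (p. 129).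
* [Kottwitz1992] R. Kottwitz, *Points on some Shimura varieties over finite fields*, J. Amer. Math. Soc. 5 (1992), §5 (pp. 389–391).
* [RapoportSmithlingZhang2020Diagonal] M. Rapoport, B. Smithling, W. Zhang, *Arithmetic diagonal cycles on unitary Shimura varieties*, Compos. Math. 156 (2020), §4.1 Thm. 4.1 (p. 17).
-/

set_option autoImplicit false

noncomputable section

namespace Summit.HodgeConjecture.HodgeConjecture.Cruxes.HLiu418.F0P6aQuotientFibreEngineInputs

set_option linter.dupNamespace false  -- `Summit.HodgeConjecture.HodgeConjecture.…` BY DESIGN (D-0017)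

open CategoryTheory CategoryTheory.Limits AlgebraicGeometry NumberField IsDedekindDomain MulAction
open scoped Matrix Polynomial Pointwise MonoidalCategory MonObj nonZeroDivisors
open Literature.NumberTheory.GaloisRepresentations
open Literature.NumberTheory.Automorphic Literature.NumberTheory.Automorphic.UnitaryGroup
open Literature.AlgebraicGeometry.ShimuraVarieties.UnitaryCanonicalModel
open Literature.NumberTheory.Automorphic.Liu2021.AppendixC
open Literature.AlgebraicGeometry.Motives (AlgPoints IntegralModel SchemeOver thickening AbelianVariety CartierDivisor)
open Literature.NumberTheory.DiophantineGeometry (geomResidueField specResidueField)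
open Literature.AlgebraicGeometry.RelativeSpec (ActionOver)
open Literature.AlgebraicGeometry.AbelianSchemes Literature.AlgebraicGeometry.AbelianSchemes.AbelianSchemeOver
open Summit.HodgeConjecture.HodgeConjecture.Cruxes.HLiu418.F0P6aModuliDatumDefs
open Summit.HodgeConjecture.HodgeConjecture.Cruxes.HLiu418.F0P6aRGDAssembly

/-! ### §1 Rows that need only an abelian scheme `𝒜 → 𝓨` over the localised model (instances, `λ`, `hpol`, `hsurj`, dominance) -/

section Generic

variable {F : Type} [Field F] [NumberField F] {X : SchemeOver F} (𝓜 : IntegralModel (𝓞 F) F X) (w : HeightOneSpectrum (𝓞 F))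
  (𝒜 : AbelianSchemeOver (𝓜.localise w).total.left) (xbar : AlgPoints (𝓜.localise w).reductionAt (geomResidueField w))

/-- `[IsCommMonObj A_x̄.X]`: the group law of the special fibre `A_x̄ = sch₀Of 𝓜 w 𝒜 x̄` is commutative (an abelian scheme over the Noetherian base `Spec κ̄(w)`;
★ `isCommMonObj_of_isLocallyNoetherian_base`). [cite: MumfordFogartyKirwan1994, Ch. 6 §1 Corollary 6.5 (p. 117)] [cite: MumfordAV1970, §4 Rigidity lemma (p. 43)] -/
theorem isCommMonObj_sch₀Of : IsCommMonObj (sch₀Of 𝓜 w 𝒜 xbar).X :=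
  AbelianSchemeOver.isCommMonObj_of_isLocallyNoetherian_base _

/-- `[IsCommMonObj Â_x̄.X]` for the dual abelian scheme of the special fibre. [cite: MumfordFogartyKirwan1994, Ch. 6 §1 Corollary 6.5 (p. 117)] -/
theorem isCommMonObj_dual₀Of_hat (D : 𝒜.DualPair) : IsCommMonObj (dual₀Of 𝓜 w 𝒜 D xbar).hat.X :=
  AbelianSchemeOver.isCommMonObj_of_isLocallyNoetherian_base _

/-- `[IsSeparated (A_x̄.X.hom ≫ 𝟙 (Spec κ̄))]` (★ QF `isSeparated_hom_comp_id`). [cite: MumfordFogartyKirwan1994, Ch. 6 §1 Definition 6.1 (p. 115)] -/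
theorem isSeparated_sch₀Of : IsSeparated ((sch₀Of 𝓜 w 𝒜 xbar).X.hom ≫ 𝟙 (Spec (.of (geomResidueField w)))) :=
  (sch₀Of 𝓜 w 𝒜 xbar).isSeparated_hom_comp_id

/-- `[LocallyOfFiniteType (A_x̄.X.hom ≫ 𝟙 (Spec κ̄))]` (★ QF `locallyOfFiniteType_hom_comp_id`). [cite: MumfordFogartyKirwan1994, Ch. 6 §1 Definition 6.1 (p. 115)] -/
theorem locallyOfFiniteType_sch₀Of : LocallyOfFiniteType ((sch₀Of 𝓜 w 𝒜 xbar).X.hom ≫ 𝟙 (Spec (.of (geomResidueField w)))) :=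
  (sch₀Of 𝓜 w 𝒜 xbar).locallyOfFiniteType_hom_comp_id

/-- `[IsSeparated (Â_x̄.X.hom ≫ 𝟙 (Spec κ̄))]`. [cite: MumfordFogartyKirwan1994, Ch. 6 §1 Definition 6.1 (p. 115)] -/
theorem isSeparated_dual₀Of_hat (D : 𝒜.DualPair) :
    IsSeparated ((dual₀Of 𝓜 w 𝒜 D xbar).hat.X.hom ≫ 𝟙 (Spec (.of (geomResidueField w)))) :=
  (dual₀Of 𝓜 w 𝒜 D xbar).hat.isSeparated_hom_comp_id

/-- `[LocallyOfFiniteType (Â_x̄.X.hom ≫ 𝟙 (Spec κ̄))]`. [cite: MumfordFogartyKirwan1994, Ch. 6 §1 Definition 6.1 (p. 115)] -/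
theorem locallyOfFiniteType_dual₀Of_hat (D : 𝒜.DualPair) :
    LocallyOfFiniteType ((dual₀Of 𝓜 w 𝒜 D xbar).hat.X.hom ≫ 𝟙 (Spec (.of (geomResidueField w)))) :=
  (dual₀Of 𝓜 w 𝒜 D xbar).hat.locallyOfFiniteType_hom_comp_id

/-- `hA`: the special fibre has the relative dimension of `𝒜` (★ `IsOfRelDim.baseChange`, twice). [cite: MumfordFogartyKirwan1994, Ch. 6 §1 (p. 115)] -/
theorem isOfRelDim_sch₀Of {g : ℕ} (h : 𝒜.IsOfRelDim g) : (sch₀Of 𝓜 w 𝒜 xbar).IsOfRelDim g :=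
  (h.baseChange _).baseChange _

/-- `[IsMonHom lam]` for `lam := (pol₀Of 𝓜 w 𝒜 pol x̄).lam` (the `isMonHom` field of the base-changed polarisation). [cite: MumfordFogartyKirwan1994, Ch. 6 §2 Definition 6.3 (p. 120)] -/
theorem isMonHom_pol₀Of_lam {D : 𝒜.DualPair} (pol : 𝒜.Polarization D) : IsMonHom (pol₀Of 𝓜 w 𝒜 pol xbar).lam :=
  (pol₀Of 𝓜 w 𝒜 pol xbar).isMonHom

/-- **`hpol`**: at every geometric point `s` of `Spec κ̄(w)`, `λ_x̄` is `Λ(𝒪(Θ))` for some Cartier divisor `Θ` on the fibre — the `exists_ample` field of the polarisation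
`pol₀Of 𝓜 w 𝒜 pol x̄` with ampleness dropped; binder text of ★ `nonempty_dualPair_quotient_idealTorsion_geometric` verbatim. [cite: MumfordFogartyKirwan1994, Ch. 6 §2 Definition 6.3 (p. 120)] -/
theorem hpol_sch₀Of {D : 𝒜.DualPair} (pol : 𝒜.Polarization D) :
    ∀ ⦃Ω' : Type⦄ [Field Ω'] [IsAlgClosed Ω'] (s : Spec (.of Ω') ⟶ Spec (.of (geomResidueField w))),
      ∃ Θ : CartierDivisor ((sch₀Of 𝓜 w 𝒜 xbar).fibre s).toAbelianVariety.X.left,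
        (sch₀Of 𝓜 w 𝒜 xbar).IsLambdaOfAt s (dual₀Of 𝓜 w 𝒜 D xbar) (pol₀Of 𝓜 w 𝒜 pol xbar).lam Θ := by
  intro Ω' _ _ s
  obtain ⟨Θ, -, hΘ⟩ := (pol₀Of 𝓜 w 𝒜 pol xbar).exists_ample Ω' s
  exact ⟨Θ, hΘ⟩

/-- **`hsurj`**: `ι(r)_s` is onto on `A_{x̄,s}(Ω′)` for every `r ≠ 0` in `𝓞 F`, every geometric point `s` (★ p849277 `map_fibreHom_i_surjective_of_ne_zero` at the base-changed
action); binder text of ★ `nonempty_dualPair_quotient_idealTorsion_geometric` verbatim (`O := 𝓞 F`). [cite: MumfordAV1970, §6 Application 2 (p. 62) and §19 Thm. 3 (p. 174)] -/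
theorem hsurj_sch₀Of (ρ : 𝒜.RingAction (𝓞 F)) :
    ∀ ⦃Ω' : Type⦄ [Field Ω'] [IsAlgClosed Ω'] (s : Spec (.of Ω') ⟶ Spec (.of (geomResidueField w))) (r : 𝓞 F), r ≠ 0 →
      haveI := ((ρ.baseChange (pullback.fst (𝓜.localise w).total.hom (specResidueField w))).baseChange xbar.left).isMonHom r
      Function.Surjective (fun x : ((sch₀Of 𝓜 w 𝒜 xbar).fibre s).toAbelianVariety.Points Ω' =>
        AlgPoints.map (fibreHom (((ρ.baseChange (pullback.fst (𝓜.localise w).total.hom (specResidueField w))).baseChange xbar.left).i r) s).hom.hom.hom x) :=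
  fun _ _ _ s _ hr => map_fibreHom_i_surjective_of_ne_zero _ s hr

/-- **DOMINANCE of `ι(b)_s` for `b ≠ 0`** (the `IsDominant` conjunct of `hros`; ★ `isDominant_toSchemeHom_fibreHom_i_of_ne_zero`, any field `Ω′`).
[cite: MumfordAV1970, §6 Application 2 (p. 62) and §19 Thm. 3 (p. 174)] -/
theorem isDominant_sch₀Of (ρ : 𝒜.RingAction (𝓞 F)) ⦃Ω' : Type⦄ [Field Ω'] (s : Spec (.of Ω') ⟶ Spec (.of (geomResidueField w)))
    {b : 𝓞 F} (hb : b ≠ 0) :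
    haveI := ((ρ.baseChange (pullback.fst (𝓜.localise w).total.hom (specResidueField w))).baseChange xbar.left).isMonHom b
    IsDominant (AbelianVariety.Hom.toSchemeHom
      (fibreHom (((ρ.baseChange (pullback.fst (𝓜.localise w).total.hom (specResidueField w))).baseChange xbar.left).i b) s)) :=
  isDominant_toSchemeHom_fibreHom_i_of_ne_zero _ s hb

end Generic

/-! ### §2 The Rosati row of `I : RGDInputsAt …` on the special fibre, and the `hros` package -/

section Rosati

variable {F : Type} [Field F] [NumberField F] [IsCMField F] {ι₁ : F →+* ℂ}
    {Jstar : Matrix (Fin 2) (Fin 2) F}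
    {K₀ : C5.OpenCompactSubgroup ↥(finAdelic ↥(maximalRealSubfield F) F (IsCMField.complexConj F) 2 Jstar)}
    {S : RecordSystemGS F Jstar ι₁ K₀} {hU7ₛ : S.HeckeTranslateDefinedOver}
    {hJ : (Jstar.map (IsCMField.complexConj F))ᵀ = Jstar} {hJu : IsUnit Jstar}
    {Fi : Type} [Field Fi] [Algebra F Fi] {Kc : C5.SmallLevel K₀} {G : Type} [Group G]
    {𝓜 : IntegralModel (𝓞 F) F ((thickening F Fi).obj (S.M.obj Kc))}
    {w : HeightOneSpectrum (𝓞 F)} {hw : (IsCMField.complexConj F) • w ≠ w} {h𝓨 : (𝓜.localise w).IsSmoothProper 1}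
    {θ : ActionOver (𝓜.localise w).total.hom ((Fi ≃ₐ[F] Fi) × G)}
    {e : Fi →ₐ[F] AlgebraicClosure (w.adicCompletion F)}
    (I : RGDInputsAt F ι₁ Jstar K₀ S hU7ₛ hJ hJu Fi Kc G 𝓜 w hw h𝓨 θ e)
    (xbar : AlgPoints (𝓜.localise w).reductionAt (geomResidueField w))

set_option backward.isDefEq.respectTransparency false in
set_option maxHeartbeats 400000 in
/-- **THE ROSATI ROW ON THE SPECIAL FIBRE**: `ι(b̄)_x̄ ≫ λ_x̄ = λ_x̄ ≫ ι(b)_x̄^∨` for `(b̄ : F) = c (b : F)` — the spine row `I.rosati` carried through the base changes along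
`ι_s` and `x̄` (★ `RingAction.rosati_row_baseChange`, twice; `(pol.baseChange f).lam` IS `baseChangeHom pol.lam f` and `dual₀Of` IS the double `DualPair.baseChange`, both `rfl`).
[cite: Kottwitz1992, §5 (p. 390)] [cite: RapoportSmithlingZhang2020Diagonal, §4.1 Thm. 4.1 (p. 17)] [cite: MumfordAV1970, §20 (p. 186) and §23 Thm. 2 (p. 231)] -/
theorem rosati_sch₀Of (b b' : 𝓞 F) (h : (b' : F) = (IsCMField.complexConj F) (b : F)) :
    haveI := ((I.act.baseChange (pullback.fst (𝓜.localise w).total.hom (specResidueField w))).baseChange xbar.left).isMonHom b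
    ((I.act.baseChange (pullback.fst (𝓜.localise w).total.hom (specResidueField w))).baseChange xbar.left).i b' ≫
        (pol₀Of 𝓜 w I.univ I.pol xbar).lam =
      (pol₀Of 𝓜 w I.univ I.pol xbar).lam ≫
        DualPair.dualIsogenyOver (((I.act.baseChange (pullback.fst (𝓜.localise w).total.hom (specResidueField w))).baseChange xbar.left).i b)
          (dual₀Of 𝓜 w I.univ I.dual xbar) (dual₀Of 𝓜 w I.univ I.dual xbar) := by
  haveI := I.pol.isMonHom
  have h₁ := RingAction.rosati_row_baseChange (pullback.fst (𝓜.localise w).total.hom (specResidueField w)) I.act I.dual I.pol.lam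
    (fun b b' : 𝓞 F => (b' : F) = (IsCMField.complexConj F) (b : F)) I.rosati
  have h₂ := RingAction.rosati_row_baseChange xbar.left
    (I.act.baseChange (pullback.fst (𝓜.localise w).total.hom (specResidueField w)))
    (I.dual.baseChange (pullback.fst (𝓜.localise w).total.hom (specResidueField w)))
    (baseChangeHom I.pol.lam (pullback.fst (𝓜.localise w).total.hom (specResidueField w)))
    (fun b b' : 𝓞 F => (b' : F) = (IsCMField.complexConj F) (b : F)) h₁ b b' h
  exact h₂

set_option backward.isDefEq.respectTransparency false in
set_option maxHeartbeats 400000 in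
/-- **`hros` — THE ROSATI-PARTNER BINDER of ★ `nonempty_dualPair_quotient_idealTorsion_geometric` at `A_x̄`**, for any ideals `𝔟, 𝔟′ ⊆ 𝓞 F` such that every `j ∈ 𝔟′` is the
conjugate of some `b ∈ 𝔟` (`(j : F) = c (b : F)`): for `j ∈ 𝔟′ ∖ 0` the partner `b ∈ 𝔟` is `≠ 0`, `ι(b)_s` is dominant (§1) and the Rosati row holds (`rosati_sch₀Of`).
[cite: MumfordAV1970, §20 (p. 186) and §23 Thm. 2 (p. 231)] [cite: Kottwitz1992, §5 (p. 390)] -/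
theorem hros_sch₀Of {𝔟 𝔟' : Ideal (𝓞 F)} (hconj : ∀ j ∈ 𝔟', ∃ b ∈ 𝔟, (j : F) = (IsCMField.complexConj F) (b : F)) :
    ∀ ⦃Ω' : Type⦄ [Field Ω'] [IsAlgClosed Ω'] (s : Spec (.of Ω') ⟶ Spec (.of (geomResidueField w))), ∀ j ∈ 𝔟', j ≠ 0 → ∃ b ∈ 𝔟,
      (haveI := ((I.act.baseChange (pullback.fst (𝓜.localise w).total.hom (specResidueField w))).baseChange xbar.left).isMonHom b
       IsDominant (AbelianVariety.Hom.toSchemeHom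
        (fibreHom (((I.act.baseChange (pullback.fst (𝓜.localise w).total.hom (specResidueField w))).baseChange xbar.left).i b) s))) ∧
      (haveI := ((I.act.baseChange (pullback.fst (𝓜.localise w).total.hom (specResidueField w))).baseChange xbar.left).isMonHom b
       ((I.act.baseChange (pullback.fst (𝓜.localise w).total.hom (specResidueField w))).baseChange xbar.left).i j ≫
          (pol₀Of 𝓜 w I.univ I.pol xbar).lam =
        (pol₀Of 𝓜 w I.univ I.pol xbar).lam ≫
          DualPair.dualIsogenyOver (((I.act.baseChange (pullback.fst (𝓜.localise w).total.hom (specResidueField w))).baseChange xbar.left).i b)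
            (dual₀Of 𝓜 w I.univ I.dual xbar) (dual₀Of 𝓜 w I.univ I.dual xbar)) := by
  intro Ω' _ _ s j hj hj0
  obtain ⟨b, hb, hjb⟩ := hconj j hj
  have hb0 : b ≠ 0 := by
    rintro rfl
    apply hj0
    apply RingOfIntegers.coe_injective
    rw [RingOfIntegers.coe_eq_algebraMap] at hjb
    simpa using hjb
  exact ⟨b, hb, isDominant_sch₀Of 𝓜 w I.univ xbar I.act s hb0, rosati_sch₀Of I xbar b j hjb⟩

-- (K6 ★ twin — gate `dedup.landed`, dealer LA3-plan (g5) v2): the tree's LOCAL copy of `exists_mem_coe_eq_complexConj_of_mem_smul`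
-- (`Lines/F0_P6a_QuotientFibreEngineInputs.lean` :203–:214) is DELETED here; the landed, token-identical ★
-- `Literature.NumberTheory.NumberFields.exists_mem_coe_eq_complexConj_of_mem_smul` (GaloisConjugatePrimeIdealArithmetic :300) is cited by FQN
-- at its one call site below (`hros_sch₀Of_complexConj_smul`); no other module names the local copy.  Every other byte = tree ED. of record.

set_option backward.isDefEq.respectTransparency false in
set_option maxHeartbeats 400000 in
/-- **`hros` for `𝔟′ := c • 𝔟`** (the (ρ-𝔟) numerology `𝔠 · c•𝔟 = (n)` of ★ `exists_complexConj_smul_partner`): binder text of ★ `nonempty_dualPair_quotient_idealTorsion_geometric`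
at `A_x̄` with `𝔟' := (IsCMField.complexConj F) • 𝔟`. [cite: MumfordAV1970, §20 (p. 186) and §23 Thm. 2 (p. 231)] [cite: Kottwitz1992, §5 (p. 390)] -/
theorem hros_sch₀Of_complexConj_smul (𝔟 : Ideal (𝓞 F)) :
    ∀ ⦃Ω' : Type⦄ [Field Ω'] [IsAlgClosed Ω'] (s : Spec (.of Ω') ⟶ Spec (.of (geomResidueField w))), ∀ j ∈ (IsCMField.complexConj F) • 𝔟, j ≠ 0 →
      ∃ b ∈ 𝔟,
      (haveI := ((I.act.baseChange (pullback.fst (𝓜.localise w).total.hom (specResidueField w))).baseChange xbar.left).isMonHom b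
       IsDominant (AbelianVariety.Hom.toSchemeHom
        (fibreHom (((I.act.baseChange (pullback.fst (𝓜.localise w).total.hom (specResidueField w))).baseChange xbar.left).i b) s))) ∧
      (haveI := ((I.act.baseChange (pullback.fst (𝓜.localise w).total.hom (specResidueField w))).baseChange xbar.left).isMonHom b
       ((I.act.baseChange (pullback.fst (𝓜.localise w).total.hom (specResidueField w))).baseChange xbar.left).i j ≫
          (pol₀Of 𝓜 w I.univ I.pol xbar).lam =
        (pol₀Of 𝓜 w I.univ I.pol xbar).lam ≫
          DualPair.dualIsogenyOver (((I.act.baseChange (pullback.fst (𝓜.localise w).total.hom (specResidueField w))).baseChange xbar.left).i b)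
            (dual₀Of 𝓜 w I.univ I.dual xbar) (dual₀Of 𝓜 w I.univ I.dual xbar)) :=
  hros_sch₀Of I xbar (Literature.NumberTheory.NumberFields.exists_mem_coe_eq_complexConj_of_mem_smul 𝔟)

end Rosati

/-! ### §3 TIE: the rows ARE the engine's inputs — ★ `nonempty_dualPair_quotient_idealTorsion_geometric` at `A_x̄`, numerology ∕ kernels ∕ level ∕ count left as binders -/

section Tie

variable {F : Type} [Field F] [NumberField F] [IsCMField F] {ι₁ : F →+* ℂ}
    {Jstar : Matrix (Fin 2) (Fin 2) F}
    {K₀ : C5.OpenCompactSubgroup ↥(finAdelic ↥(maximalRealSubfield F) F (IsCMField.complexConj F) 2 Jstar)}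
    {S : RecordSystemGS F Jstar ι₁ K₀} {hU7ₛ : S.HeckeTranslateDefinedOver}
    {hJ : (Jstar.map (IsCMField.complexConj F))ᵀ = Jstar} {hJu : IsUnit Jstar}
    {Fi : Type} [Field Fi] [Algebra F Fi] {Kc : C5.SmallLevel K₀} {G : Type} [Group G]
    {𝓜 : IntegralModel (𝓞 F) F ((thickening F Fi).obj (S.M.obj Kc))}
    {w : HeightOneSpectrum (𝓞 F)} {hw : (IsCMField.complexConj F) • w ≠ w} {h𝓨 : (𝓜.localise w).IsSmoothProper 1}
    {θ : ActionOver (𝓜.localise w).total.hom ((Fi ≃ₐ[F] Fi) × G)}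
    {e : Fi →ₐ[F] AlgebraicClosure (w.adicCompletion F)}

set_option backward.isDefEq.respectTransparency false in
set_option maxHeartbeats 400000 in
/-- **THE DUAL PAIR OF `A_x̄ ∕ K` from the pack**: ★ p849273 at `A := sch₀Of 𝓜 w I.univ x̄` with every tuple row discharged by §§1–2 and `𝔟′ := c • 𝔟`; the remaining
binders (`(n : κ̄) ≠ 0`, `c•𝔟 ≠ 0`, `𝔠 · c•𝔟 = (n)`, the kernels `K ⊆ A_x̄[𝔟]`, `K₂ ⊆ A_x̄[𝔠]`, the hat level structure `φ`, `λ_*K₂ ⊆ range φ`, `#K·#λ_*K₂ = n^{2g}`) are exactly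
LA3-p03's (2b) rows. [cite: MumfordAV1970, §15 Thm. 1 (p. 143) and §23 Thm. 2 (p. 231)] -/
theorem nonempty_dualPair_quotient_sch₀Of
    (I : RGDInputsAt F ι₁ Jstar K₀ S hU7ₛ hJ hJu Fi Kc G 𝓜 w hw h𝓨 θ e)
    (xbar : AlgPoints (𝓜.localise w).reductionAt (geomResidueField w))
    {n : ℕ} (hn0 : (n : geomResidueField w) ≠ 0) {𝔟 𝔠 : Ideal (𝓞 F)} (h𝔟'0 : (IsCMField.complexConj F) • 𝔟 ≠ ⊥)
    (h𝔠 : 𝔠 * (IsCMField.complexConj F) • 𝔟 = Ideal.span {(n : 𝓞 F)})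
    (K : Subgroup (sch₀Of 𝓜 w I.univ xbar).Sections) [Finite K] (hK : ∀ σ : K, (σ : (sch₀Of 𝓜 w I.univ xbar).Sections) ^ n = 1)
    (hK𝔟 : ∀ (κ : K), ∀ b ∈ 𝔟, (κ : (sch₀Of 𝓜 w I.univ xbar).Sections) ≫
      ((I.act.baseChange (pullback.fst (𝓜.localise w).total.hom (specResidueField w))).baseChange xbar.left).i b = 1)
    (K₂ : Subgroup (sch₀Of 𝓜 w I.univ xbar).Sections) [Finite K₂] (hK₂ : ∀ σ : K₂, (σ : (sch₀Of 𝓜 w I.univ xbar).Sections) ^ n = 1)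
    (hK₂𝔠 : ∀ (σ : K₂), ∀ r ∈ 𝔠, (σ : (sch₀Of 𝓜 w I.univ xbar).Sections) ≫
      ((I.act.baseChange (pullback.fst (𝓜.localise w).total.hom (specResidueField w))).baseChange xbar.left).i r = 1)
    (φ : LevelStructure I.g n (dual₀Of 𝓜 w I.univ I.dual xbar).hat)
    (hK'φ : ((K₂.map (haveI := isMonHom_pol₀Of_lam 𝓜 w I.univ xbar I.pol
        IsMonHom.monoidHom (pol₀Of 𝓜 w I.univ I.pol xbar).lam (𝟙_ (Over (Spec (.of (geomResidueField w))))))) :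
        Set (dual₀Of 𝓜 w I.univ I.dual xbar).hat.Sections) ⊆ Set.range φ.section_)
    (hcard : Nat.card K * Nat.card (K₂.map (haveI := isMonHom_pol₀Of_lam 𝓜 w I.univ xbar I.pol
        IsMonHom.monoidHom (pol₀Of 𝓜 w I.univ I.pol xbar).lam (𝟙_ (Over (Spec (.of (geomResidueField w))))))) = n ^ (2 * I.g)) :
    haveI := isSeparated_sch₀Of 𝓜 w I.univ xbar
    haveI := locallyOfFiniteType_sch₀Of 𝓜 w I.univ xbar
    Nonempty ((sch₀Of 𝓜 w I.univ xbar).quotientBy (𝟙 (Spec (.of (geomResidueField w)))) K ((sch₀Of 𝓜 w I.univ xbar).hcov_of_field K)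
      ((sch₀Of 𝓜 w I.univ xbar).exists_grpObj_isMonHom_quotientMk_of_field K ((sch₀Of 𝓜 w I.univ xbar).hcov_of_field K))
      ((sch₀Of 𝓜 w I.univ xbar).smooth_quotientOver_hom_of_field K ((sch₀Of 𝓜 w I.univ xbar).hcov_of_field K))
      ((sch₀Of 𝓜 w I.univ xbar).geometricallyConnected_quotientOver_hom (𝟙 (Spec (.of (geomResidueField w)))) K
        ((sch₀Of 𝓜 w I.univ xbar).hcov_of_field K))).DualPair := by
  -- every instance argument is passed EXPLICITLY (the same constants the statement inlines), so the result type is the statement token for token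
  exact @AbelianSchemeOver.nonempty_dualPair_quotient_idealTorsion_geometric (geomResidueField w) _ _ (sch₀Of 𝓜 w I.univ xbar)
    (isCommMonObj_sch₀Of 𝓜 w I.univ xbar) (isSeparated_sch₀Of 𝓜 w I.univ xbar) (locallyOfFiniteType_sch₀Of 𝓜 w I.univ xbar)
    (dual₀Of 𝓜 w I.univ I.dual xbar) (isCommMonObj_dual₀Of_hat 𝓜 w I.univ xbar I.dual)
    (isSeparated_dual₀Of_hat 𝓜 w I.univ xbar I.dual) (locallyOfFiniteType_dual₀Of_hat 𝓜 w I.univ xbar I.dual) I.g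
    (isOfRelDim_sch₀Of 𝓜 w I.univ xbar I.relDim) (pol₀Of 𝓜 w I.univ I.pol xbar).lam (isMonHom_pol₀Of_lam 𝓜 w I.univ xbar I.pol)
    (hpol_sch₀Of 𝓜 w I.univ xbar I.pol) (𝓞 F) _ _
    ((I.act.baseChange (pullback.fst (𝓜.localise w).total.hom (specResidueField w))).baseChange xbar.left)
    (hsurj_sch₀Of 𝓜 w I.univ xbar I.act) n hn0 𝔟 ((IsCMField.complexConj F) • 𝔟) 𝔠 h𝔟'0 h𝔠 (hros_sch₀Of_complexConj_smul I xbar 𝔟)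
    K _ hK hK𝔟 K₂ _ hK₂ hK₂𝔠 φ hK'φ hcard

end Tie


/-! ### §4 TIE 2: LA3-p03's ★ (2b) head `exists_idealClass_quotient_kernelLaw_dualPair` (p849490) at `A_x̄`, every tuple row discharged -/

section Tie2

variable {F : Type} [Field F] [NumberField F] [IsCMField F] {ι₁ : F →+* ℂ}
    {Jstar : Matrix (Fin 2) (Fin 2) F}
    {K₀ : C5.OpenCompactSubgroup ↥(finAdelic ↥(maximalRealSubfield F) F (IsCMField.complexConj F) 2 Jstar)}
    {S : RecordSystemGS F Jstar ι₁ K₀} {hU7ₛ : S.HeckeTranslateDefinedOver}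
    {hJ : (Jstar.map (IsCMField.complexConj F))ᵀ = Jstar} {hJu : IsUnit Jstar}
    {Fi : Type} [Field Fi] [Algebra F Fi] {Kc : C5.SmallLevel K₀} {G : Type} [Group G]
    {𝓜 : IntegralModel (𝓞 F) F ((thickening F Fi).obj (S.M.obj Kc))}
    {w : HeightOneSpectrum (𝓞 F)} {hw : (IsCMField.complexConj F) • w ≠ w} {h𝓨 : (𝓜.localise w).IsSmoothProper 1}
    {θ : ActionOver (𝓜.localise w).total.hom ((Fi ≃ₐ[F] Fi) × G)}
    {e : Fi →ₐ[F] AlgebraicClosure (w.adicCompletion F)}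
    (I : RGDInputsAt F ι₁ Jstar K₀ S hU7ₛ hJ hJu Fi Kc G 𝓜 w hw h𝓨 θ e)

/-- **`hchar` at `κ̄(w)`**: every prime `q` vanishing in `κ̄(w)` (characteristic `p = I.pChar`, `I.charP₀`) divides any `M` with `p ∣ M` — the `hchar` binder of ★
`exists_idealClass_quotient_kernelLaw_dualPair` for `M := p·N`, `p·N·#K(Θ)`, … [cite: MilneANT2008, Thm. 3.7] -/
theorem hchar_sch₀Of {M : ℕ} (hpM : I.pChar ∣ M) : ∀ q : ℕ, q.Prime → (q : geomResidueField w) = 0 → q ∣ M := by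
  intro q hq h0
  haveI := I.charP₀
  have hpq : I.pChar ∣ q := (CharP.cast_eq_zero_iff (geomResidueField w) I.pChar q).mp h0
  rw [← (Nat.prime_dvd_prime_iff_eq I.hpChar.1 hq).mp hpq]
  exact hpM

/-- **`hrosati` at `A_x̄` in LA3-p03's shape** (`c := MulSemiringAction.toRingEquiv _ (𝓞 F) (complexConj F)`, `c b = complexConj • b`, whose image in `F` is
`complexConj (b : F)` by `rfl`): `ι(c b)_x̄ ≫ λ_x̄ = λ_x̄ ≫ ι(b)_x̄^∨` (§2 `rosati_sch₀Of`). [cite: Kottwitz1992, §5 (p. 390)] [cite: MumfordAV1970, §20 (p. 186) and §23 Thm. 2 (p. 231)] -/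
theorem hrosati_sch₀Of (xbar : AlgPoints (𝓜.localise w).reductionAt (geomResidueField w)) :
    ∀ b : 𝓞 F, b ≠ 0 →
      haveI := ((I.act.baseChange (pullback.fst (𝓜.localise w).total.hom (specResidueField w))).baseChange xbar.left).isMonHom b
      ((I.act.baseChange (pullback.fst (𝓜.localise w).total.hom (specResidueField w))).baseChange xbar.left).i
          (MulSemiringAction.toRingEquiv _ (𝓞 F) (IsCMField.complexConj F) b) ≫ (pol₀Of 𝓜 w I.univ I.pol xbar).lam =
        (pol₀Of 𝓜 w I.univ I.pol xbar).lam ≫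
          DualPair.dualIsogenyOver (((I.act.baseChange (pullback.fst (𝓜.localise w).total.hom (specResidueField w))).baseChange xbar.left).i b)
            (dual₀Of 𝓜 w I.univ I.dual xbar) (dual₀Of 𝓜 w I.univ I.dual xbar) :=
  fun b _ => rosati_sch₀Of I xbar b _ rfl

set_option backward.isDefEq.respectTransparency false in
set_option maxHeartbeats 400000 in
/-- **THE (2b) HEAD AT `A_x̄` — «DUAL-Q» for a class representative `𝔟 = x·𝔞` prime to `M` (`p ∣ M`), with the ideal-shape kernel law and the unit pin**: ★ p849490
`exists_idealClass_quotient_kernelLaw_dualPair` with `hA`, `[IsMonHom lam]`, `hpol` (WITH ampleness: the `exists_ample` field of `pol₀Of`), `act`, `c`, `hrosati`, `hchar` all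
discharged from `I` — the Lines-side consumer (LA3-p01's ROOF-LEGS ∕ the leaf pen) supplies only `𝔞 ≠ 0`, `M ≠ 0`, `p ∣ M` (e.g. `M := p·N`).  The statement reads
(destructure with `obtain ⟨x, 𝔟, n, K, hfin, DQ, hx, h𝔟, hcls, hcop𝔟, hn, hcopn, hnmem, hn0, hK, hker, hunit⟩`): `∃ (x : F) (𝔟 : Ideal (𝓞 F)) (n : ℕ)
(K : Subgroup A_x̄.Sections) (hfin : Finite K) (DQ : (A_x̄ ∕ K).DualPair), x ≠ 0 ∧ 𝔟 ≠ ⊥ ∧ ↑𝔟 = spanSingleton x * ↑𝔞 ∧ 𝔟 ⊔ (M) = ⊤ ∧ 0 < n ∧ Nat.Coprime n M ∧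
↑n ∈ 𝔟 ∧ (n : κ̄(w)) ≠ 0 ∧ (∀ σ, σ ∈ K ↔ ∀ b ∈ 𝔟, σ ≫ ι(b)_x̄ = 1) ∧ (∀ T (t : T ⟶ A_x̄), t ≫ q_K = 1 ↔ ∀ b ∈ 𝔟, t ≫ ι(b)_x̄ = 1) ∧ Nonempty (unit pin of DQ)`.
[cite: MumfordAV1970, §23 Thm. 2 (p. 231), §15 Thm. 1 (p. 143), §7 Thm. 4 (p. 72)] [cite: MilneANT2008, Thm. 3.7 and Rem. 3.12] -/
theorem exists_idealClass_quotient_kernelLaw_dualPair_sch₀Of (xbar : AlgPoints (𝓜.localise w).reductionAt (geomResidueField w))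
    (𝔞 : Ideal (𝓞 F)) (h𝔞 : 𝔞 ≠ ⊥) {M : ℕ} (hM : M ≠ 0) (hpM : I.pChar ∣ M) :
    -- the TYPE is ★ p849490's conclusion at `A := sch₀Of …`, `D := dual₀Of …`, `lam := (pol₀Of …).lam`, `act := (I.act.baseChange ι_s).baseChange x̄.left`,
    -- `c := toRingEquiv (complexConj F)` — spelled through `type_of%` so that it is that instantiation TOKEN FOR TOKEN (a hand-expanded copy elaborates
    -- to a defeq-but-costlier term: > 400 000 heartbeats to unify; this form needs the default budget twice)
    type_of% (@AbelianSchemeOver.exists_idealClass_quotient_kernelLaw_dualPair (geomResidueField w) _ _ (sch₀Of 𝓜 w I.univ xbar)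
      (isSeparated_sch₀Of 𝓜 w I.univ xbar) (locallyOfFiniteType_sch₀Of 𝓜 w I.univ xbar) (dual₀Of 𝓜 w I.univ I.dual xbar) I.g
      (isOfRelDim_sch₀Of 𝓜 w I.univ xbar I.relDim) (pol₀Of 𝓜 w I.univ I.pol xbar).lam (isMonHom_pol₀Of_lam 𝓜 w I.univ xbar I.pol)
      (fun Ω' _ _ s => (pol₀Of 𝓜 w I.univ I.pol xbar).exists_ample Ω' s) F _ _
      ((I.act.baseChange (pullback.fst (𝓜.localise w).total.hom (specResidueField w))).baseChange xbar.left)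
      (MulSemiringAction.toRingEquiv _ (𝓞 F) (IsCMField.complexConj F)) (hrosati_sch₀Of I xbar) 𝔞 h𝔞 M hM (hchar_sch₀Of I hpM)) :=
  @AbelianSchemeOver.exists_idealClass_quotient_kernelLaw_dualPair (geomResidueField w) _ _ (sch₀Of 𝓜 w I.univ xbar)
    (isSeparated_sch₀Of 𝓜 w I.univ xbar) (locallyOfFiniteType_sch₀Of 𝓜 w I.univ xbar) (dual₀Of 𝓜 w I.univ I.dual xbar) I.g
    (isOfRelDim_sch₀Of 𝓜 w I.univ xbar I.relDim) (pol₀Of 𝓜 w I.univ I.pol xbar).lam (isMonHom_pol₀Of_lam 𝓜 w I.univ xbar I.pol)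
    (fun Ω' _ _ s => (pol₀Of 𝓜 w I.univ I.pol xbar).exists_ample Ω' s) F _ _
    ((I.act.baseChange (pullback.fst (𝓜.localise w).total.hom (specResidueField w))).baseChange xbar.left)
    (MulSemiringAction.toRingEquiv _ (𝓞 F) (IsCMField.complexConj F)) (hrosati_sch₀Of I xbar) 𝔞 h𝔞 M hM (hchar_sch₀Of I hpM)

end Tie2

end Summit.HodgeConjecture.HodgeConjecture.Cruxes.HLiu418.F0P6aQuotientFibreEngineInputs

end
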